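/-
HarnessLib.Audit.TribunalTags — registry attributes for the KERNEL half of the pre-birth tribunal (D-0034, tribunal-as-fitness):
the Strong-Hypothesis Library (`Literature/StrongHypotheses/<S>.lean`) and method-family tags on barrier / route decls.
Imports `Lean` only (cheap: a Literature file may import it directly). Kept apart from `HarnessLib.Audit.Tags` ON PURPOSE:
`Tags` is imported by every route file, so adding attributes there would rebuild the whole Summits tree; this module is
imported only by the library files and by `HarnessLib.Audit.Tribunal`. NOT part of the generated root `HarnessLib.lean`.
-/
import Lean

/-!
# Tribunal registry tags (D-0034)

They CHECK nothing; `#h21_tribunal` (module `HarnessLib.Audit.Tribunal`) reads them.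

* `@[strong_hypothesis "S.P"]` — the decl is a KNOWN STRONG HYPOTHESIS for problem `P` of summit `S` (`"PneNP.PneNP"`,
  `"RiemannHypothesis.RiemannHypothesis"`, `"CriticalPhenomena.CardyFormulaZ2"`; `"S"` alone = every problem of `S`): an open
  named conjecture `def H : Prop := …` (usually already in Literature — then `attribute [strong_hypothesis "S.P"] Literature.….H`)
  that is KNOWN (landed or printed) to imply `P`. T1 rule (a) of D-0033: a crux `C` with `H → C` is summit-strength.
* `@[summit_bridge "S.P"]` — the decl records THAT implication: either a `theorem h : H → P'` (LANDED bridge; `P'` = the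
  problem statement's Literature form, so no `Summits` import is needed) or a named fact `def HImpliesP : Prop := H → P'`
  (PRINTED bridge, `[cite: …]` to where the implication is proved; discharged later as `theorem HImpliesP_holds`). The tribunal
  reads the bridge's hypothesis head to learn which `H` it belongs to; a strong hypothesis without a bridge is still probed
  but reported `bridge: none` (informational, not decisive).
* `@[method_family "tok tok …"]` — whitespace/comma-separated technique-class tokens of a barrier decl (new barrier files;
  legacy files carry the `technique_class:` docstring block, matched textually by the CLI) or of a route's deciding theorem.
* `@[hard_core "S" "print name"]` — the decl is a FAMOUS OPEN SUB-SUMMIT PROBLEM of summit `S` (strictly weaker than or incomparable to S,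
  open in print; FILTER-SYNTHESIS 2026-08-18 F1): `Literature/HardCores/<S>.lean` states/tags them, `Summits/<S>/HardCores.lean` tags existing
  item decls. The tribunal's t1h clause flags a crux C with `C → HC` / `HC ↔ C` / C tagged itself: never a FAIL — a `hard-core:<HC>` flag that
  sends the route to the frontier shelf unless it is the core's OWNER (`@[hard_core_owner "route-…"]` on the same decl).

Every application records `(decl, attr, arg)` with the index of the module that applied it, exactly like `HarnessLib.Audit.Tags`.
-/

open Lean

namespace HarnessLib.Audit.TribunalTags

/-- One recorded tribunal-registry tag. -/
structure Rec where
  decl : Name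
  attr : Name
  arg  : String := ""
  deriving Inhabited, Repr, BEq

/-- Extension state: every tag with the index of the module that applied it (`none` = the current module). -/
structure State where
  recs : Array (Rec × Option Nat) := #[]
  deriving Inhabited

initialize tribunalTagExt : SimplePersistentEnvExtension Rec State ←
  registerSimplePersistentEnvExtension {
    addEntryFn := fun s r => { s with recs := s.recs.push (r, none) }
    addImportedFn := fun arrs => Id.run do
      let mut recs : Array (Rec × Option Nat) := #[]
      for h : i in [0:arrs.size] do
        for r in arrs[i] do
          recs := recs.push (r, some i)
      return { recs }
  }

/-- A tag as the tribunal sees it: `origin` = module that applied it (`none` = this file). -/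
structure Tag where
  decl   : Name
  attr   : Name
  arg    : String
  origin : Option Name
  deriving Inhabited, Repr, BEq

/-- All tribunal-registry tags in `env` (imported first, then local), origins resolved to module names. -/
def allTags (env : Environment) : Array Tag :=
  (tribunalTagExt.getState env).recs.map fun (r, oi) =>
    { decl := r.decl, attr := r.attr, arg := r.arg,
      origin := oi.bind fun i => (env.header.modules[i]?).map (·.module) }

/-- Tags of one attribute (`strong_hypothesis` / `summit_bridge` / `method_family`). -/
def tagsWithAttr (env : Environment) (attr : Name) : Array Tag :=
  (allTags env).filter (·.attr == attr)

/-- Does the summit key `arg` (as written in the attribute) cover problem key `want` (`"S.P"` or `"S"`)?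
`"S"` covers every `"S.P"`; `"S.P"` covers `"S.P"` and `"S"`. Comparison is by string components. -/
def keyCovers (arg want : String) : Bool :=
  let a := arg.splitOn "."
  let w := want.splitOn "."
  match a, w with
  | [s], (s' :: _) => s == s'
  | (s :: p :: _), [s'] => s == s' || p == s'
  | (s :: p :: _), (s' :: p' :: _) => s == s' && p == p'
  | _, _ => arg == want

/-- `@[strong_hypothesis "S.P"]` — known strong hypothesis for problem `P` of summit `S`. -/
syntax (name := strong_hypothesis) "strong_hypothesis " str : attr
/-- `@[summit_bridge "S.P"]` — landed (`theorem : H → P`) or printed (`def … : Prop := H → P`) bridge of a strong hypothesis. -/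
syntax (name := summit_bridge) "summit_bridge " str : attr
/-- `@[method_family "tok tok …"]` — technique-class tokens of a barrier decl or a route's deciding theorem. -/
syntax (name := method_family) "method_family " str : attr
/-- `@[hard_core "S" "print name"]` — famous open sub-summit problem of summit `S`. -/
syntax (name := hard_core) "hard_core " str (ppSpace str)? : attr
/-- `@[hard_core_owner "route-id"]` — the ONE route that attacks this hard core as its typed target (exempt from the hard-core shelf). -/
syntax (name := hard_core_owner) "hard_core_owner " str : attr

private def record (decl attr : Name) (arg : String) (kind : AttributeKind) : AttrM Unit := do
  unless kind == AttributeKind.global do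
    throwError "tribunal registry tags are global only (no `local`/`scoped`)"
  modifyEnv fun env => tribunalTagExt.addEntry env { decl, attr, arg }

initialize registerBuiltinAttribute {
  name := `strong_hypothesis
  descr := "known strong hypothesis for a summit problem: @[strong_hypothesis \"S.P\"]"
  applicationTime := .afterTypeChecking
  add := fun decl stx kind => do
    match stx with
    | `(attr| strong_hypothesis $s:str) => record decl `strong_hypothesis s.getString kind
    | _ => throwError "malformed @[strong_hypothesis]: expected @[strong_hypothesis \"Summit.Problem\"]"
}

initialize registerBuiltinAttribute {
  name := `summit_bridge
  descr := "bridge H → P of a strong hypothesis (theorem = landed, def Prop = printed): @[summit_bridge \"S.P\"]"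
  applicationTime := .afterTypeChecking
  add := fun decl stx kind => do
    match stx with
    | `(attr| summit_bridge $s:str) => record decl `summit_bridge s.getString kind
    | _ => throwError "malformed @[summit_bridge]: expected @[summit_bridge \"Summit.Problem\"]"
}

initialize registerBuiltinAttribute {
  name := `method_family
  descr := "technique-class tokens: @[method_family \"sieve parity-sensitive …\"]"
  applicationTime := .afterTypeChecking
  add := fun decl stx kind => do
    match stx with
    | `(attr| method_family $s:str) => record decl `method_family s.getString kind
    | _ => throwError "malformed @[method_family]: expected @[method_family \"tok tok …\"]"
}

initialize registerBuiltinAttribute {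
  name := `hard_core
  descr := "famous open sub-summit problem: @[hard_core \"S\" \"print name\"]"
  applicationTime := .afterTypeChecking
  add := fun decl stx kind => do
    match stx with
    | `(attr| hard_core $s:str $[$p:str]?) =>
      record decl `hard_core s.getString kind
      if let some p := p then record decl `hard_core_print p.getString kind
    | _ => throwError "malformed @[hard_core]: expected @[hard_core \"Summit\" \"print name\"]"
}

initialize registerBuiltinAttribute {
  name := `hard_core_owner
  descr := "owner route of a hard core: @[hard_core_owner \"route-…\"]"
  applicationTime := .afterTypeChecking
  add := fun decl stx kind => do
    match stx with
    | `(attr| hard_core_owner $r:str) => record decl `hard_core_owner r.getString kind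
    | _ => throwError "malformed @[hard_core_owner]: expected @[hard_core_owner \"route-id\"]"
}

end HarnessLib.Audit.TribunalTags
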